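import Summits.ValiantsHypothesis.ValiantsHypothesis.Theorems.KPlusLogSqLawWeakLiftingTowerGraftTowerRowTwoSym
import Summits.ValiantsHypothesis.ValiantsHypothesis.Theorems.KPlusLogSqLawWeakLiftingTowerGraftSizeSuperadditive
import Summits.ValiantsHypothesis.ValiantsHypothesis.Theorems.LacunarySymmetroidMatrixDescartesDescartesSharpOnSupport

/-!
# Tower graft line — the `m = 2` tower floor `3K − 4` propagated to every size by direct sums:
# `ζ₊(m; d) ≥ ⌊m/2⌋·(3K − 4) + (m mod 2)·(K − 1)` on every 2-tower `d`

Short corollary file (LINE (B) `tower_graft`, crux `WeakLifting` stmt-ValiantsHypothesis-19561; NO stub claimed) of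
`…TowerGraftTowerRowTwoSym` (`not_posRootLawOn_two_tower`: `ζ₊(2; d) ≥ 3K − 4` on every 2-tower, p818253) with the tree's size
superadditivity (`not_posRootLawOn_mul`, `not_posRootLawOn_add`: block-diagonal direct sums of rescaled copies, p-landed
`…TowerGraftSizeSuperadditive`) and the size-`1` Descartes floor (`DescartesSharp.not_posRootLawOn_one`):

* `not_posRootLawOn_even_tower` — `¬ PosRootLawOn (2(n+1)) K ((n+1)(3K−4) − 1) d`;
* `not_posRootLawOn_odd_tower` — `¬ PosRootLawOn (2(n+1)+1) K ((n+1)(3K−4) + K − 2) d`;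
* ★ `floor_tower_sizes` — for every `m ≥ 1`, every 2-tower `d` with `K ≥ 3` letters and every valid class budget:
  `(m/2)·(3K − 4) + (m % 2)·(K − 1) ≤ B` — against the tree's diagonal floor `m(K − 1)` (`DescartesSharp.le_of_posRootLawOn`), a factor
  `3/2` in the `K`-slope at every size; every `m`-tower (`m ≥ 2`) is a 2-tower, so these are floors for the tower laws TowerB / S5 / S4d in
  census currency (calibration from below of the budgets `2^C·B + 2^{C·log₂² m}`; all linear, far inside Conjecture B).

HONEST FRAMING: direct sums certify only ADDITIVE growth in `m` (the cell's located tower records `4m − 2` at `K = 4` are coupled letters);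
nothing on S4/S4b/S5/S5ᴸ, TowerB, `WeakLifting`, Conjecture B, `MatrixDescartes` (18050) or `VP ≠ VNP`.  Def-free.
Seat: prover leafhand-val-kpluslogsqlaw-1 g3, `--supports stmt-ValiantsHypothesis-19561`.  [folklore] block-diagonal direct sums.
-/

set_option linter.dupNamespace false
set_option autoImplicit false

namespace Summit.ValiantsHypothesis.ValiantsHypothesis.Theorems.KPlusLogSqLaw.TowerGraft

open Summit.ValiantsHypothesis.ValiantsHypothesis.Theorems.LacunarySymmetroidMatrixDescartes (PosRootLawOn)

namespace TowerRowTwoSym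

variable {K : ℕ}

/-- **even sizes**: `ζ₊(2(n+1); d) ≥ (n+1)(3K − 4)` on every 2-tower (`n + 1` rescaled diagonal blocks of the `m = 2` design). [this work] -/
theorem not_posRootLawOn_even_tower (hK : 3 ≤ K) (d : Fin K → ℕ) (hd : ∀ l l' : Fin K, l < l' → 2 * d l < d l') (n : ℕ) :
    ¬ PosRootLawOn ((n + 1) * 2) K ((n + 1) * (3 * K - 4) - 1) d := by
  have h := not_posRootLawOn_mul (not_posRootLawOn_two_tower hK d hd) n
  rwa [show 3 * K - 5 + 1 = 3 * K - 4 by omega] at h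

/-- **odd sizes**: `ζ₊(2(n+1) + 1; d) ≥ (n+1)(3K − 4) + K − 1` on every 2-tower (the even design plus one Descartes-sharp `1 × 1` block).
[this work] -/
theorem not_posRootLawOn_odd_tower (hK : 3 ≤ K) (d : Fin K → ℕ) (hd : ∀ l l' : Fin K, l < l' → 2 * d l < d l') (n : ℕ) :
    ¬ PosRootLawOn ((n + 1) * 2 + 1) K ((n + 1) * (3 * K - 4) + K - 2) d := by
  have hinj : Function.Injective d :=
    (show StrictMono d from fun l l' h => by have := hd l l' h; omega).injective
  have h1 := LacunarySymmetroidMatrixDescartes.DescartesSharp.not_posRootLawOn_one (K := K) (by omega) hinj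
  have h := not_posRootLawOn_add (not_posRootLawOn_even_tower hK d hd n) h1
  have hK1 : 1 ≤ 3 * K - 4 := by omega
  have hpos : 1 ≤ (n + 1) * (3 * K - 4) := by nlinarith
  rwa [show (n + 1) * (3 * K - 4) - 1 + (K - 2) + 1 = (n + 1) * (3 * K - 4) + K - 2 by omega] at h

/-- ★ **TOWER FLOORS AT EVERY SIZE**: on a 2-tower `d` with `K ≥ 3` letters, every valid class budget at size `m ≥ 1` satisfies
`(m/2)·(3K − 4) + (m % 2)·(K − 1) ≤ B` (natural division). [this work] -/
theorem floor_tower_sizes (hK : 3 ≤ K) {d : Fin K → ℕ} (hd : ∀ l l' : Fin K, l < l' → 2 * d l < d l') {m B : ℕ} (hm : 1 ≤ m)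
    (h : PosRootLawOn m K B d) : m / 2 * (3 * K - 4) + m % 2 * (K - 1) ≤ B := by
  have hinj : Function.Injective d :=
    (show StrictMono d from fun l l' h => by have := hd l l' h; omega).injective
  obtain ⟨n, hn⟩ : ∃ n, m = 2 * n + m % 2 := ⟨m / 2, by omega⟩
  have hmod : m % 2 = 0 ∨ m % 2 = 1 := Nat.mod_two_eq_zero_or_one m
  have hdiv : m / 2 = n := by omega
  rw [hdiv]
  rcases hmod with h0 | h1
  · -- even size `m = 2n`, `n ≥ 1`
    rw [h0, zero_mul, add_zero]
    have hn1 : 1 ≤ n := by omega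
    obtain ⟨n', rfl⟩ : ∃ n', n = n' + 1 := ⟨n - 1, by omega⟩
    have hm' : m = (n' + 1) * 2 := by omega
    by_contra hB
    rw [not_le] at hB
    apply not_posRootLawOn_even_tower hK d hd n'
    rw [← hm']
    exact fun S hS => (h S hS).trans (by omega)
  · rw [h1, one_mul]
    rcases Nat.eq_zero_or_pos n with hn0 | hnpos
    · -- `m = 1`: the Descartes floor `K − 1`
      subst hn0
      have hm1 : m = 1 := by omega
      subst hm1
      have := LacunarySymmetroidMatrixDescartes.DescartesSharp.le_of_posRootLawOn (m := 1) le_rfl (by omega) hinj h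
      omega
    · obtain ⟨n', rfl⟩ : ∃ n', n = n' + 1 := ⟨n - 1, by omega⟩
      have hm' : m = (n' + 1) * 2 + 1 := by omega
      by_contra hB
      rw [not_le] at hB
      apply not_posRootLawOn_odd_tower hK d hd n'
      rw [← hm']
      exact fun S hS => (h S hS).trans (by omega)

/-! ## 2. Four letters: every 2-tower beats the located tower records of the two-sided words (rev 2) -/

/-- **`(3, 4)` on every 2-tower: `ζ₊(3; d) ≥ 11`** — `¬ PosRootLawOn 3 4 10 d`.  Exceeds the cell's kernel tower record `10` of the two-sided
`3 × 3` word on the 3-tower `(0,1,5,25)` (`…TowerTwoSidedWitnessTen`; `…SizeSuperadditive.not_posRootLawOn_three_0_1_5_25 : ¬ PosRootLawOn 3 4 9`),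
with GENERAL symmetric letters (the `m = 2` design is indefinite) and NO coupling between the blocks. [this work] -/
theorem not_posRootLawOn_three_four_tower (d : Fin 4 → ℕ) (hd : ∀ l l' : Fin 4, l < l' → 2 * d l < d l') :
    ¬ PosRootLawOn 3 4 10 d := by
  have h := not_posRootLawOn_odd_tower (K := 4) (by norm_num) d hd 0
  norm_num at h
  exact h

/-- **`(4, 4)` on every 2-tower: `ζ₊(4; d) ≥ 16`** — `¬ PosRootLawOn 4 4 15 d`.  Exceeds the located/kernel tower record `14 = 4m − 2` of the
two-sided `4 × 4` word on `(0,1,5,25)` (`…TowerTwoSidedWitnessFourteen`) and the direct sum `12 = 3m` of `…SizeSuperadditive`. [this work] -/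
theorem not_posRootLawOn_four_four_tower (d : Fin 4 → ℕ) (hd : ∀ l l' : Fin 4, l < l' → 2 * d l < d l') :
    ¬ PosRootLawOn 4 4 15 d := by
  have h := not_posRootLawOn_even_tower (K := 4) (by norm_num) d hd 1
  norm_num at h
  exact h

/-- the genuine 4-tower `(0, 1, 5, 25)` of the cell's two-sided witnesses is a 2-tower. -/
theorem tower_0_1_5_25 : ∀ l l' : Fin 4, l < l' → 2 * (![0, 1, 5, 25] : Fin 4 → ℕ) l < (![0, 1, 5, 25] : Fin 4 → ℕ) l' := by
  decide

/-- `ζ₊(3; (0,1,5,25)) ≥ 11` (was `≥ 10`). [this work] -/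
theorem not_posRootLawOn_three_0_1_5_25_ten : ¬ PosRootLawOn 3 4 10 (![0, 1, 5, 25] : Fin 4 → ℕ) :=
  not_posRootLawOn_three_four_tower _ tower_0_1_5_25

/-- `ζ₊(4; (0,1,5,25)) ≥ 16` (was `≥ 14`). [this work] -/
theorem not_posRootLawOn_four_0_1_5_25_fifteen : ¬ PosRootLawOn 4 4 15 (![0, 1, 5, 25] : Fin 4 → ℕ) :=
  not_posRootLawOn_four_four_tower _ tower_0_1_5_25

end TowerRowTwoSym

end Summit.ValiantsHypothesis.ValiantsHypothesis.Theorems.KPlusLogSqLaw.TowerGraft
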